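import Summits.Ventures.HSemireg.Pad4FirstOrderModelTopFlag

/-!
# Venture HSemireg — THEOREM L^ζ step S3a: BLOCK CALCULUS for the first-order model (how a row of (E1) is read on one
# Künneth block; companion of `Pad4FirstOrderModel.lean`, row 716; TIER-2, infrastructure under the column reading S3 and THE END)

HONEST FRAMING. PROVED bookkeeping about the first-order MODEL of the PAD-4 anchor (seat s4-prove-1 g24, TRACK S4-PUSH lane
(ii), 2026-08-27). `TheoremLZetaMain` ∕ `TheoremLZeta` (p505821) stay kernel-OPEN (`@[conjecture]`); nothing here proves them.
WHAT IS PROVED: (1) `sum_idxH2_ite` — the `u.1 = q` guard of `lowerLHS` ∕ `upperLHS` restricts the unknown index to the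
block `Π_g idx (rel · · g) (q g)`; (2) `sum_piFinset_pair` ∕ `sum_piFinset_single` — a sum over a block whose factors off
two (one) chosen factors are the singleton `{(0,0)}` is a double (single) sum; (3) `coefProd_split2` ∕ `coefProd_split3` —
the product coefficient is the product of the two (three) non-trivial per-factor coefficients; (4) the per-factor `coef`
table entries used by S3 ∕ THE END (evaluation, transpose, ring product, `w_ζ`, identity, and the vanishing `e > d`);
(5) `rel` in closed form from class data (`rel_pos_of_lt`, `rel_zero_symm`, `rel_congr`) and `monIdx_zero`,
`mulCoef_comm`; (6) `coefProd_wImage_eq_zero_of_eval` — the `w_{ζ_f}`-combination of a product whose `f`-factor is an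
evaluation pairing `R_d^* × R_d → Ξ_ζ` vanishes (the general form of S2a's contributor lemma, any row). No variety, sheaf
or semiregularity map is constructed; nothing here says HC ∕ HC_CM ∕ HC_AV holds; no fact, no definition, no instance, no
notation. REUSE: rows 716, 731 (`coefProd_eq_mul_erase`), 739, S2a (`mem_idxH2_iff`, `mem_idxH0_iff`), S2c.
FRAMING OF RECORD (director-hodge g10, cell INBOX l.31483 (a)): everything in this file is a theorem of the finite-dimensional
FIRST-ORDER MODEL of row 716 (`Pad4FirstOrderModel.lean`) and of nothing else; the model-to-sheaf bridge (Buchweitz–Flenner 2003)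
is NOT in the tree; the cell's (S3) ∕ (S5) STATUS WORDS do not move; no object is certified; nothing here bears on HC ∕ HC_CM ∕
HC_AV ∕ W₆ or on `stub_rung_pad4_seedAt`.
Typed ≠ proved ≠ endorsed.
-/

noncomputable section
namespace Summit.Ventures.HSemireg.Pad4FirstOrder
open Finset

/-! ## (1) Restricting the unknown index to one degree distribution -/

/-- the `u.1 = q` guard restricts a sum over `idxH2 Y X` to the block `Π_g idx (rel Y X g) (q g)` of the distribution `q`. -/
theorem sum_idxH2_ite (Y X : Constituent) (q : Fin 4 → ℕ) (hq : q ∈ qDist2)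
    (F : (Fin 4 → ℕ) → (Fin 4 → ℕ × ℕ) → ℂ) :
    ∑ u ∈ idxH2 Y X, (if u.1 = q then F u.1 u.2 else 0) =
      ∑ o ∈ Fintype.piFinset (fun g => idx (rel Y X g) (q g)), F q o := by
  classical
  rw [← Finset.sum_filter]
  refine Finset.sum_nbij' Prod.snd (Prod.mk q) ?_ ?_ ?_ ?_ ?_
  · intro u hu
    rw [mem_filter, mem_idxH2_iff] at hu
    exact Fintype.mem_piFinset.mpr fun g => hu.2 ▸ hu.1.2 g
  · intro o ho
    rw [mem_filter, mem_idxH2_iff]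
    exact ⟨⟨hq, Fintype.mem_piFinset.mp ho⟩, rfl⟩
  · intro u hu
    rw [mem_filter] at hu
    exact Prod.ext hu.2.symm rfl
  · intro o _; rfl
  · intro u hu
    rw [mem_filter] at hu
    rw [hu.2]

/-! ## (2) Sums over blocks with singleton factors -/

/-- the base index: `ē_A` ∕ the constant `1` ∕ the monomial `1` on every factor. -/
theorem update_update_apply_of_ne {σ f g : Fin 4} (hgσ : g ≠ σ) (hgf : g ≠ f) (x y : ℕ × ℕ) :
    Function.update (Function.update (fun _ : Fin 4 => ((0 : ℕ), (0 : ℕ))) σ x) f y g = (0, 0) := by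
  rw [Function.update_of_ne hgf, Function.update_of_ne hgσ]

/-- a sum over a block `Π_g S g` whose factors off `{σ, f}` are `{(0,0)}` is a double sum over `S σ × S f`. -/
theorem sum_piFinset_pair (S : Fin 4 → Finset (ℕ × ℕ)) (σ f : Fin 4) (hσf : σ ≠ f)
    (h0 : ∀ g, g ≠ σ → g ≠ f → S g = {((0 : ℕ), (0 : ℕ))}) (G : (Fin 4 → ℕ × ℕ) → ℂ) :
    ∑ o ∈ Fintype.piFinset S, G o =
      ∑ x ∈ S σ, ∑ y ∈ S f, G (Function.update (Function.update (fun _ => ((0 : ℕ), (0 : ℕ))) σ x) f y) := by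
  classical
  rw [← Finset.sum_product']
  symm
  refine Finset.sum_nbij' (fun p => Function.update (Function.update (fun _ => ((0 : ℕ), (0 : ℕ))) σ p.1) f p.2)
    (fun o => (o σ, o f)) ?_ ?_ ?_ ?_ ?_
  · intro p hp
    rw [mem_product] at hp
    refine Fintype.mem_piFinset.mpr fun g => ?_
    by_cases hgf : g = f
    · subst hgf; rw [Function.update_self]; exact hp.2
    · by_cases hgσ : g = σ
      · subst hgσ; rw [Function.update_of_ne hgf, Function.update_self]; exact hp.1
      · rw [update_update_apply_of_ne hgσ hgf, h0 g hgσ hgf]; exact mem_singleton_self _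
  · intro o ho
    exact mem_product.mpr ⟨Fintype.mem_piFinset.mp ho σ, Fintype.mem_piFinset.mp ho f⟩
  · intro p _
    simp only [Function.update_self, Function.update_of_ne hσf]
  · intro o ho
    funext g
    by_cases hgf : g = f
    · subst hgf; rw [Function.update_self]
    · by_cases hgσ : g = σ
      · subst hgσ; rw [Function.update_of_ne hgf, Function.update_self]
      · rw [update_update_apply_of_ne hgσ hgf]
        have := Fintype.mem_piFinset.mp ho g
        rw [h0 g hgσ hgf, mem_singleton] at this
        exact this.symm
  · intro p _; rfl

/-- a sum over a block `Π_g S g` whose factors off `f` are `{(0,0)}` is a single sum over `S f`. -/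
theorem sum_piFinset_single (S : Fin 4 → Finset (ℕ × ℕ)) (f : Fin 4) (h0 : ∀ g, g ≠ f → S g = {((0 : ℕ), (0 : ℕ))})
    (G : (Fin 4 → ℕ × ℕ) → ℂ) :
    ∑ o ∈ Fintype.piFinset S, G o = ∑ y ∈ S f, G (Function.update (fun _ => ((0 : ℕ), (0 : ℕ))) f y) := by
  classical
  symm
  refine Finset.sum_nbij' (fun y => Function.update (fun _ => ((0 : ℕ), (0 : ℕ))) f y) (fun o => o f) ?_ ?_ ?_ ?_ ?_
  · intro y hy
    refine Fintype.mem_piFinset.mpr fun g => ?_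
    by_cases hgf : g = f
    · subst hgf; rw [Function.update_self]; exact hy
    · rw [Function.update_of_ne hgf, h0 g hgf]; exact mem_singleton_self _
  · intro o ho; exact Fintype.mem_piFinset.mp ho f
  · intro y _; simp only [Function.update_self]
  · intro o ho
    funext g
    by_cases hgf : g = f
    · subst hgf; rw [Function.update_self]
    · rw [Function.update_of_ne hgf]
      have := Fintype.mem_piFinset.mp ho g
      rw [h0 g hgf, mem_singleton] at this
      exact this.symm
  · intro y _; rfl

/-! ## (3) Splitting the product coefficient -/

/-- if every factor off `{σ, f}` contributes `1`, the product coefficient is the product of the `σ`- and `f`-coefficients. -/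
theorem coefProd_split2 (rU rS : Fin 4 → Rel) (q : Fin 4 → ℕ) (ι a o : Fin 4 → ℕ × ℕ) (σ f : Fin 4) (hσf : σ ≠ f)
    (h1 : ∀ g, g ≠ σ → g ≠ f → coef (rU g) (q g) (ι g) (rS g) (a g) (o g) = 1) :
    coefProd rU rS q ι a o =
      coef (rU σ) (q σ) (ι σ) (rS σ) (a σ) (o σ) * coef (rU f) (q f) (ι f) (rS f) (a f) (o f) := by
  rw [coefProd_eq_mul_erase _ _ _ _ _ _ f, ← Finset.mul_prod_erase _ _ (mem_erase.mpr ⟨hσf, mem_univ σ⟩),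
    Finset.prod_eq_one fun g hg => h1 g (ne_of_mem_erase hg) (ne_of_mem_erase (mem_of_mem_erase hg))]
  ring

/-- if every factor off `{σ, f, τ}` contributes `1`, the product coefficient is the product of three coefficients. -/
theorem coefProd_split3 (rU rS : Fin 4 → Rel) (q : Fin 4 → ℕ) (ι a o : Fin 4 → ℕ × ℕ) (σ f τ : Fin 4)
    (hσf : σ ≠ f) (hστ : σ ≠ τ) (hfτ : f ≠ τ)
    (h1 : ∀ g, g ≠ σ → g ≠ f → g ≠ τ → coef (rU g) (q g) (ι g) (rS g) (a g) (o g) = 1) :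
    coefProd rU rS q ι a o =
      coef (rU σ) (q σ) (ι σ) (rS σ) (a σ) (o σ) * coef (rU f) (q f) (ι f) (rS f) (a f) (o f) *
        coef (rU τ) (q τ) (ι τ) (rS τ) (a τ) (o τ) := by
  rw [coefProd_eq_mul_erase _ _ _ _ _ _ f, ← Finset.mul_prod_erase _ _ (mem_erase.mpr ⟨hσf, mem_univ σ⟩),
    ← Finset.mul_prod_erase _ _ (mem_erase.mpr ⟨hστ.symm, mem_erase.mpr ⟨hfτ.symm, mem_univ τ⟩⟩),
    Finset.prod_eq_one fun g hg => h1 g (ne_of_mem_erase (mem_of_mem_erase hg))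
      (ne_of_mem_erase (mem_of_mem_erase (mem_of_mem_erase hg))) (ne_of_mem_erase hg)]
  ring

/-! ## (4) The per-factor coefficient table (PAD4-LEAK §1 dictionary entries, as used) -/

/-- class `0` section: the identity on the unknown's coordinate. -/
theorem coef_zero_right (rU : Rel) (q : ℕ) (ι a o : ℕ × ℕ) : coef rU q ι Rel.zero a o = if o = ι then 1 else 0 := by
  simp [coef]

/-- `H⁰(O) × R_e → R_e`: plain multiplication by the constant (`q = 0`). -/
theorem coef_zero_zero_pos (ι : ℕ × ℕ) (e : ℕ) (k : Fin 4) (a o : ℕ × ℕ) :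
    coef Rel.zero 0 ι (Rel.pos e k) a o = if o = a then 1 else 0 := by
  simp [coef]

/-- `R_c(⊗W) × R_e → R_{c+e}(⊗W)`: the ring product (same phase). -/
theorem coef_pos_pos (c e : ℕ) (k : Fin 4) (q : ℕ) (ι a o : ℕ × ℕ) :
    coef (Rel.pos c k) q ι (Rel.pos e k) a o = (mulCoef ι a o : ℂ) := by
  simp [coef]

/-- `R_d^* × R_e → R_{d−e}^*` for `e < d`: the transposed ring product (same phase). -/
theorem coef_neg_pos_lt (d e : ℕ) (k : Fin 4) (q : ℕ) (ι a o : ℕ × ℕ) (h : e < d) :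
    coef (Rel.neg d k) q ι (Rel.pos e k) a o = (mulCoef a o ι : ℂ) := by
  simp [coef, h]

/-- `R_d^* × R_e → 0` for `e > d`: no target. -/
theorem coef_neg_pos_gt (d e : ℕ) (k k' : Fin 4) (q : ℕ) (ι a o : ℕ × ℕ) (h : d < e) :
    coef (Rel.neg d k) q ι (Rel.pos e k') a o = 0 := by
  simp [coef, show ¬ e < d by omega, show e ≠ d by omega]

/-- the evaluation pairing `(R_d^* ⊗ W) × R_d → Ξ_ζ ⊗ W = Λ²V ≅ ℂ` (`q = 2`): `[a = ι] · [o = (0,0)]`. -/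
theorem coef_neg_two_pos_self (d : ℕ) (k : Fin 4) (ι a o : ℕ × ℕ) :
    coef (Rel.neg d k) 2 ι (Rel.pos d k) a o = if a = ι ∧ o = (0, 0) then 1 else 0 := by
  simp [coef]

/-- `ξ̄_ζ(ē_A) = 1`. -/
theorem xiBar_A (k : Fin 4) : xiBar k (0, 0) = 1 := by simp [xiBar]
/-- `ξ̄_ζ(ē_B) = ζ̄`. -/
theorem xiBar_B (k : Fin 4) : xiBar k (1, 0) = zetaBar k := by simp [xiBar]
/-- `w_ζ(ē_A) = −ζ̄`. -/
theorem wCoef_A (k : Fin 4) : wCoef k (0, 0) = -zetaBar k := by simp [wCoef]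
/-- `w_ζ(ē_B) = 1`. -/
theorem wCoef_B (k : Fin 4) : wCoef k (1, 0) = 1 := by simp [wCoef]

/-- `R_0 = ℂ·1`: the only Riemann–Roch monomial of pole order `≤ 0`. -/
theorem monIdx_zero : monIdx 0 = {((0 : ℕ), (0 : ℕ))} := by decide

/-- `1 ∈ R_d` for every `d`. -/
theorem zero_mem_monIdx (d : ℕ) : ((0 : ℕ), (0 : ℕ)) ∈ monIdx d := by simp [monIdx]

/-- `idx zero 1 = {ē_A, ē_B}` (the piece `V`). -/
theorem idx_zero_one : idx Rel.zero 1 = {((0 : ℕ), (0 : ℕ)), (1, 0)} := rfl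
/-- `idx zero 0 = {1}` (the piece `H⁰(O) = ℂ`). -/
theorem idx_zero_zero : idx Rel.zero 0 = {((0 : ℕ), (0 : ℕ))} := rfl
/-- `idx (pos e) 0 = monIdx e` (the piece `R_e`). -/
theorem idx_pos_zero (e : ℕ) (k : Fin 4) : idx (Rel.pos e k) 0 = monIdx e := rfl
/-- `idx (pos e) 1 = monIdx e` (the piece `R_e ⊗ W`). -/
theorem idx_pos_one (e : ℕ) (k : Fin 4) : idx (Rel.pos e k) 1 = monIdx e := rfl
/-- `idx (neg d) 1 = monIdx d` (the piece `R_d^*`). -/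
theorem idx_neg_one (d : ℕ) (k : Fin 4) : idx (Rel.neg d k) 1 = monIdx d := rfl
/-- `idx (neg d) 0 = ∅` (no sections of a negative letter; S2a `idx_neg_zero`). -/
theorem idx_pos_two (e : ℕ) (k : Fin 4) : idx (Rel.pos e k) 2 = ∅ := rfl

/-- the structure constants of `ℂ[x,y]∕(y² − x³ + x)` are symmetric in the two factors. -/
theorem mulCoef_comm (a b o : ℕ × ℕ) : mulCoef a b o = mulCoef b a o := by
  unfold mulCoef
  rw [Nat.add_comm a.2 b.2, Nat.add_comm a.1 b.1]

/-! ## (5) `rel` in closed form from class data -/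

/-- `Y` STRICTLY ABOVE `X` on one ray (or `X` uncharged under a charged `Y`): the positive letter `(c_Y − c_X) ℓ_{ζ_Y}`. -/
theorem rel_pos_of_lt (Y X : Constituent) (g : Fin 4) (hl : Y.layer = X.layer) (hlt : X.charge g < Y.charge g)
    (hph : X.charge g = 0 ∨ Y.phase g = X.phase g) :
    rel Y X g = Rel.pos (Y.charge g - X.charge g) (Y.phase g) := by
  unfold rel
  rw [if_neg (not_not.mpr hl), if_neg (by omega)]
  rcases Nat.eq_zero_or_pos (X.charge g) with h0 | hpos
  · rw [if_pos h0, h0, Nat.sub_zero]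
  · rw [if_neg (by omega), if_neg (by omega), if_neg (not_not.mpr (hph.resolve_left (by omega))), if_pos hlt]

/-- `rel = zero` is symmetric. -/
theorem rel_zero_symm (Y X : Constituent) (g : Fin 4) (h : rel Y X g = Rel.zero) : rel X Y g = Rel.zero := by
  obtain ⟨hl, hc, hp⟩ := of_rel_zero Y X g h
  refine rel_zero_of_eq X Y g hl.symm hc.symm ?_
  rcases hp with h0 | h0
  · exact Or.inl (hc.trans h0)
  · by_cases hY : Y.charge g = 0
    · exact Or.inl hY
    · exact Or.inr h0.symm

/-- `rel Y · g` only sees the class of the second argument: two constituents with `rel X X' = zero` everywhere are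
interchangeable (copies of one class may carry different junk phases on uncharged factors). -/
theorem rel_congr_right (Y X X' : Constituent) (hXX' : ∀ g, rel X X' g = Rel.zero) (g : Fin 4) :
    rel Y X g = rel Y X' g := by
  obtain ⟨hl, hc, hp⟩ := of_rel_zero X X' g (hXX' g)
  unfold rel
  rw [hl, hc]
  by_cases h0 : X'.charge g = 0
  · simp [h0]
  · have hph : X.phase g = X'.phase g := hp.resolve_left h0
    rw [hph]

/-- … and of the first argument. -/
theorem rel_congr_left (Y Y' X : Constituent) (hYY' : ∀ g, rel Y Y' g = Rel.zero) (g : Fin 4) :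
    rel Y X g = rel Y' X g := by
  obtain ⟨hl, hc, hp⟩ := of_rel_zero Y Y' g (hYY' g)
  unfold rel
  rw [hl, hc]
  by_cases h0 : Y'.charge g = 0
  · by_cases hX : X.charge g = 0 <;> simp [h0, hX]
  · have hph : Y.phase g = Y'.phase g := hp.resolve_left h0
    rw [hph]

/-! ## (6) The `w_{ζ_f}`-combination kills evaluation pairings on `f` (general form of S2a's contributor lemma) -/

/-- if on the factor `f` the unknown class is `−d ℓ_ζ`, the section class `+d ℓ_ζ` and the degree is `1` (the evaluation
pairing `R_d^* × R_d → Ξ_ζ ⊂ V_f`), then the `w_{ζ}`-combination `coefProd(o[f ↦ ē_B]) − ζ̄ · coefProd(o[f ↦ ē_A])` of the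
product coefficient vanishes, whatever the other factors are. -/
theorem coefProd_wImage_eq_zero_of_eval (rU rS : Fin 4 → Rel) (q : Fin 4 → ℕ) (ι a o : Fin 4 → ℕ × ℕ) (f : Fin 4)
    (d : ℕ) (k : Fin 4) (hU : rU f = Rel.neg d k) (hS : rS f = Rel.pos d k) (hq : q f = 1) :
    coefProd rU rS q ι a (Function.update o f (1, 0)) - zetaBar k * coefProd rU rS q ι a (Function.update o f (0, 0)) =
      0 := by
  rw [coefProd_eq_mul_erase _ _ _ _ _ _ f, coefProd_eq_mul_erase _ _ _ _ _ (Function.update o f (0, 0)) f,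
    prod_erase_update_target, prod_erase_update_target, Function.update_self, Function.update_self, hU, hS, hq,
    coef_neg_one_pos_self, coef_neg_one_pos_self]
  by_cases hι : a f = ι f
  · rw [if_pos hι, if_pos hι]
    have hw := xiBar_B_sub_zetaBar_mul_xiBar_A k
    linear_combination (∏ g ∈ univ.erase f, coef (rU g) (q g) (ι g) (rS g) (a g) (o g)) * hw
  · rw [if_neg hι, if_neg hι]; ring

end Summit.Ventures.HSemireg.Pad4FirstOrder
end
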